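import Summits.CriticalPhenomena.PercolationContinuityZ3.Theorems.PercNonProliferationFreeBoxSparseStubCollarGeom
import Mathlib.Data.Finset.Sym
import HarnessLib

/-!
# Crux `PercNonProliferation.FreeBoxSparse` (stmt-CriticalPhenomena-4445), line `ccfs-window-kissing-walls` —
# helper for stub `stub_collar`, part 5: residue tilings of `ℤ^d` by cubes of side `2r+1`

Helper file for the lead's skeleton of line `ccfs-window-kissing-walls`
(prover-line-stmt-CriticalPhenomena-4445-0); lands with `--supports stmt-CriticalPhenomena-4445`.

The template of the sprinkling argument, with `M = 2r+1`: for a residue vector `ρ ∈ [0,M)^d` the map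
`w ↦ (⌊(w_j − ρ_j + r)/M⌋)_j` tiles `ℤ^d` by cubes of side `M`, and tile `k` IS the `r`-ball
`B_r(ρ + Mk)` (`tile_eq_iff`, `tile_eq_iff_mem_ball`); a centre `a ≡ ρ (mod M)` is recovered from its
tile (`centre_eq_of_emod`), so the balls `B_r(a)`, `a ≡ ρ`, are tiles of ONE tiling
(`mem_ball_iff_tile_eq`) and distinct centres give distinct tiles; a tile meets any `Λ` in at most
`M^d` sites (`card_tile_le`), so its block of lattice edges has `≤ (M^d+1 choose 2)` edges
(`card_block_le`); and among the sites of any finite `S ⊂ ℤ^d` one of the `M^d` residue classes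
carries at least `|S|/M^d` of them (`stub_collar_residues`, pigeonhole) — summing collar rarity over
the classes costs the factor `M^d`.
-/

noncomputable section

namespace Summit.CriticalPhenomena.PercolationContinuityZ3.Theorems.FreeBoxSparse

namespace StubCollar

open Finset
open Literature.Probability.Percolation Literature.Probability.LatticeModels

variable {d : ℕ}

/-! ### Residue tilings -/

/-- **Tile = ball.** Tile `k` of the residue class `ρ` (tile index `⌊(w_j − ρ_j + r)/(2r+1)⌋`) is the
`r`-ball around `ρ + (2r+1) k`. [folklore] -/
theorem tile_eq_iff (r : ℕ) (ρ k w : Site d) :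
    (fun j => (w j - ρ j + r) / (2 * (r : ℤ) + 1)) = k ↔
      ∀ j, -(r : ℤ) ≤ w j - (ρ j + (2 * (r : ℤ) + 1) * k j) ∧
        w j - (ρ j + (2 * (r : ℤ) + 1) * k j) ≤ r := by
  rw [funext_iff]
  refine forall_congr' fun j => ?_
  rw [Int.ediv_eq_iff_of_pos (by positivity), mul_comm (k j)]
  omega

/-- Tile `k` of class `ρ`, as a ball: `w` is in tile `k` iff `w ∈ B_r(ρ + (2r+1)k)`. [folklore] -/
theorem tile_eq_iff_mem_ball (r : ℕ) (ρ k w : Site d) :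
    (fun j => (w j - ρ j + r) / (2 * (r : ℤ) + 1)) = k ↔
      w ∈ (box d r).image (· + fun j => ρ j + (2 * (r : ℤ) + 1) * k j) := by
  rw [tile_eq_iff, mem_ball_iff]

/-- **Centre recovery.** For `ρ_j = a_j mod (2r+1)`, the centre `a` is `ρ + (2r+1)·(tile of a)`.
[folklore] -/
theorem centre_eq_of_emod (r : ℕ) (a : Site d) :
    (fun j => a j % (2 * (r : ℤ) + 1) + (2 * (r : ℤ) + 1) *
      ((a j - a j % (2 * (r : ℤ) + 1) + r) / (2 * (r : ℤ) + 1))) = a := by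
  funext j
  have hM : (0 : ℤ) < 2 * r + 1 := by positivity
  have h0 := Int.emod_add_mul_ediv (a j) (2 * (r : ℤ) + 1)
  have h1 : a j - a j % (2 * (r : ℤ) + 1) + r = r + (2 * (r : ℤ) + 1) * (a j / (2 * (r : ℤ) + 1)) := by
    linarith
  rw [h1, Int.add_mul_ediv_left _ _ hM.ne', Int.ediv_eq_zero_of_lt (by positivity) (by omega),
    zero_add]
  linarith

/-- The ball around a centre `a ≡ ρ` is the tile of `a` in the tiling of class `ρ`. [folklore] -/
theorem mem_ball_iff_tile_eq (r : ℕ) (a w : Site d) :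
    w ∈ (box d r).image (· + a) ↔
      (fun j => (w j - a j % (2 * (r : ℤ) + 1) + r) / (2 * (r : ℤ) + 1)) =
        fun j => (a j - a j % (2 * (r : ℤ) + 1) + r) / (2 * (r : ℤ) + 1) := by
  rw [tile_eq_iff_mem_ball, centre_eq_of_emod r a]

/-- The residue vector of a site lies in `[0, 2r+1)^d`. [folklore] -/
theorem residue_mem (r : ℕ) (a : Site d) :
    (fun j => a j % (2 * (r : ℤ) + 1)) ∈
      Fintype.piFinset (fun _ : Fin d => Finset.Ico (0 : ℤ) (2 * (r : ℤ) + 1)) := by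
  rw [Fintype.mem_piFinset]
  intro j
  rw [Finset.mem_Ico]
  exact ⟨Int.emod_nonneg _ (by positivity), Int.emod_lt_of_pos _ (by positivity)⟩

/-- The number of residue classes is `(2r+1)^d`. [folklore] -/
theorem card_residues (r : ℕ) :
    (Fintype.piFinset (fun _ : Fin d => Finset.Ico (0 : ℤ) (2 * (r : ℤ) + 1))).card =
      (2 * r + 1) ^ d := by
  rw [Fintype.card_piFinset_const, Int.card_Ico]
  congr 1

/-- A tile of side `2r+1` has at most `(2r+1)^d` sites. [folklore] -/
theorem card_tile_le (r : ℕ) (ρ k : Site d) (Λ : Finset (Site d)) :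
    (Λ.filter fun w => (fun j => (w j - ρ j + r) / (2 * (r : ℤ) + 1)) = k).card ≤ (2 * r + 1) ^ d := by
  rw [← card_box d r]
  refine Finset.card_le_card_of_injOn (fun w => w - fun j => ρ j + (2 * (r : ℤ) + 1) * k j) ?_ ?_
  · intro w hw
    rw [Finset.mem_coe, Finset.mem_filter] at hw
    have := (tile_eq_iff r ρ k w).1 hw.2
    rw [Finset.mem_coe, mem_box]
    intro j
    have := this j
    simp only [Pi.sub_apply]
    omega
  · intro w _ w' _ h
    exact sub_left_injective h


/-! ### Blocks -/

/-- A block has at most `((2r+1)^d + 1 choose 2)` edges. [folklore] -/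
theorem card_block_le (Λ : Finset (Site d)) (r : ℕ) (ρ k : Site d) :
    ((Λ.filter fun w => (fun j => (w j - ρ j + r) / (2 * (r : ℤ) + 1)) = k).sym2.filter
        fun e => e ∈ (zdGraph d).edgeSet).card ≤ Nat.choose ((2 * r + 1) ^ d + 1) 2 :=
  calc ((Λ.filter fun w => (fun j => (w j - ρ j + r) / (2 * (r : ℤ) + 1)) = k).sym2.filter
          fun e => e ∈ (zdGraph d).edgeSet).card
      ≤ (Λ.filter fun w => (fun j => (w j - ρ j + r) / (2 * (r : ℤ) + 1)) = k).sym2.card :=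
        Finset.card_filter_le _ _
    _ = Nat.choose ((Λ.filter fun w =>
          (fun j => (w j - ρ j + r) / (2 * (r : ℤ) + 1)) = k).card + 1) 2 := Finset.card_sym2 _
    _ ≤ Nat.choose ((2 * r + 1) ^ d + 1) 2 :=
        Nat.choose_le_choose 2 (Nat.add_le_add_right (card_tile_le r ρ k Λ) 1)


end StubCollar

open Literature.Probability.LatticeModels

/-- **Registered: pigeonhole over the `(2r+1)³` residue classes of `ℤ³`.** Among the sites of a finite
`S ⊂ ℤ³` some residue class `ρ ∈ [0, 2r+1)³` (coordinatewise `a_j mod (2r+1) = ρ_j`) carries at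
least `|S|/(2r+1)³` of them. [folklore] -/
theorem stub_collar_residues : ∀ (r : ℕ) (S : Finset (Site 3)), ∃ ρ ∈ Fintype.piFinset (fun _ : Fin 3 => Finset.Ico (0 : ℤ) (2 * (r : ℤ) + 1)), S.card ≤ (2 * r + 1) ^ 3 * (S.filter fun a => (fun j => a j % (2 * (r : ℤ) + 1)) = ρ).card := by
  intro r S
  have hsum := Finset.card_eq_sum_card_fiberwise (s := S)
    (t := Fintype.piFinset (fun _ : Fin 3 => Finset.Ico (0 : ℤ) (2 * (r : ℤ) + 1)))
    (f := fun a => fun j => a j % (2 * (r : ℤ) + 1)) (fun a _ => StubCollar.residue_mem r a)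
  have hne : (Fintype.piFinset (fun _ : Fin 3 => Finset.Ico (0 : ℤ) (2 * (r : ℤ) + 1))).Nonempty :=
    ⟨_, StubCollar.residue_mem r (0 : Site 3)⟩
  refine Finset.exists_le_of_sum_le hne ?_
  rw [Finset.sum_const, StubCollar.card_residues, smul_eq_mul, ← Finset.mul_sum, ← hsum]

end Summit.CriticalPhenomena.PercolationContinuityZ3.Theorems.FreeBoxSparse
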